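import Mathlib
import Summits.PneNP.PneNP.Theorems.OverlapGapAlgebraSearchHardWindowMeanSquareRate

/-!
# PneNP / OverlapGapAlgebra — `SearchHardWindow` / `SolvableImpliesStableSection`:
# TWO-ROUND LOCAL RULES are ℓ²-stable (1/2) — combinatorics and the typically-Lipschitz ⇒ ℓ² bridge

Support for cruxes `stmt-PneNP-2460` and `stmt-PneNP-2463`. The mean-square (ℓ²-stable) theorems
(`sissMS_…`, `shwMS_…`, `shwMSR_…`) are stated for an abstract sensitivity bound. This file and its
sequel instantiate them on a NAMED natural class, with no new definitions: the TWO-ROUND LOCAL rules —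
search maps `g` whose output bit at a variable `v` is an arbitrary (label-dependent) function of the
labelled sub-instance of clauses within two rounds of `v`: the clauses containing `v`, and the clauses
sharing a variable with one of those. Formally (`hloc` below): `g Φ v = g Φ' v` whenever `Φ` and `Φ'`
agree on every clause `i` that `v` SEES in `Φ` or in `Φ'`, where `v` sees `i` iff some variable of
clause `i` is `v` or co-occurs with `v` in some clause. The class contains every one-round rule
(majority / threshold votes of the occurrences' polarities, one round of parallel local repair of a
fixed assignment — the map of the `c2` calibration block —, unit-clause-style guesses) and their
two-round compositions.

* `shwLoc_card_sees_le` — a variable-free count: at most `k + k·k·D(Φ)` variables see a given clause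
  (`D` = maximum clause-degree);
* `shwLoc_hamming_le` — under `hloc`, instances agreeing off clause `a` have outputs within Hamming
  distance `#{v sees a in Φ} + #{v sees a in Φ'}`;
* `shwLoc_hamming_update_le` — hence a single-literal change moves a two-round rule by at most
  `2k + k²(2 D(Φ) + 1)`: two-round rules are TYPICALLY LIPSCHITZ with `s(n) = 2k + k²(6 log n + 1)` at
  instances of maximum clause-degree `≤ 3 log n`;
* `shwLoc_meanSquare_of_typLipschitz` — the general bridge: a map that is `s`-Lipschitz per literal
  change at instances of maximum clause-degree `≤ 3 log n` has mean-square single-literal-resample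
  sensitivity `≤ s² + 1` (`m ≤ α n`, `e^{αke²} ≤ n³`); so the typically-Lipschitz class of
  `sissT_solvableImpliesStableSection_of_typLipschitz` sits inside the ℓ²-stable class.
No new definitions; axioms `propext`, `Classical.choice`, `Quot.sound`.
-/

set_option linter.dupNamespace false -- `Summit.PneNP.PneNP.…`: summit = sub-problem (D-0017)

namespace Summit.PneNP.PneNP.Theorems

open Finset Filter
open scoped Classical

section TwoRound

variable {m k n : ℕ}

/-- At most `k + k·(k·D Φ)` variables see a given clause `a` (some variable of `a` is the variable
itself, or co-occurs with it in some clause), `D Φ` the maximum clause-degree. -/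
theorem shwLoc_card_sees_le (Φ : Fin m → Fin k → Fin n × Bool) (a : Fin m) :
    ((univ : Finset (Fin n)).filter fun v => ∃ j : Fin k, ((Φ a j).1 = v ∨
        ∃ i' : Fin m, (∃ j', (Φ i' j').1 = v) ∧ ∃ j', (Φ i' j').1 = (Φ a j).1)).card
      ≤ k + k * (k * ((univ : Finset (Fin n)).sup fun v =>
          ((univ : Finset (Fin m)).filter fun i => ∃ j, (Φ i j).1 = v).card)) := by
  set D : ℕ := (univ : Finset (Fin n)).sup fun v =>
      ((univ : Finset (Fin m)).filter fun i => ∃ j, (Φ i j).1 = v).card with hD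
  set A : Finset (Fin n) := (univ : Finset (Fin k)).image fun j => (Φ a j).1 with hA
  set B : Finset (Fin n) := (univ : Finset (Fin k)).biUnion fun j =>
      (((univ : Finset (Fin m)).filter fun i' => ∃ j', (Φ i' j').1 = (Φ a j).1).biUnion
        fun i' => (univ : Finset (Fin k)).image fun j'' => (Φ i' j'').1) with hB
  have hsub : ((univ : Finset (Fin n)).filter fun v => ∃ j : Fin k, ((Φ a j).1 = v ∨
        ∃ i' : Fin m, (∃ j', (Φ i' j').1 = v) ∧ ∃ j', (Φ i' j').1 = (Φ a j).1)) ⊆ A ∪ B := by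
    intro v hv
    simp only [mem_filter, mem_univ, true_and] at hv
    obtain ⟨j, hj⟩ := hv
    rw [Finset.mem_union]
    rcases hj with hj | ⟨i', ⟨j', hj'⟩, ⟨j'', hj''⟩⟩
    · left
      rw [hA, Finset.mem_image]
      exact ⟨j, mem_univ _, hj⟩
    · right
      rw [hB, Finset.mem_biUnion]
      refine ⟨j, mem_univ _, ?_⟩
      rw [Finset.mem_biUnion]
      refine ⟨i', ?_, ?_⟩
      · simp only [mem_filter, mem_univ, true_and]
        exact ⟨j'', hj''⟩
      · rw [Finset.mem_image]
        exact ⟨j', mem_univ _, hj'⟩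
  have hA' : A.card ≤ k := by
    calc A.card ≤ (univ : Finset (Fin k)).card := Finset.card_image_le
      _ = k := by rw [Finset.card_univ, Fintype.card_fin]
  have hcdeg : ∀ j : Fin k,
      (((univ : Finset (Fin m)).filter fun i' => ∃ j', (Φ i' j').1 = (Φ a j).1).card) ≤ D := by
    intro j
    rw [hD]
    exact Finset.le_sup (f := fun v => ((univ : Finset (Fin m)).filter
      fun i => ∃ j, (Φ i j).1 = v).card) (mem_univ (Φ a j).1)
  have hB' : B.card ≤ k * (k * D) := by
    calc B.card ≤ ∑ j : Fin k, ((((univ : Finset (Fin m)).filter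
          fun i' => ∃ j', (Φ i' j').1 = (Φ a j).1).biUnion
            fun i' => (univ : Finset (Fin k)).image fun j'' => (Φ i' j'').1).card) :=
          Finset.card_biUnion_le
      _ ≤ ∑ _j : Fin k, k * D := by
          refine Finset.sum_le_sum fun j _ => ?_
          calc _ ≤ ∑ i' ∈ ((univ : Finset (Fin m)).filter fun i' => ∃ j', (Φ i' j').1 = (Φ a j).1),
                ((univ : Finset (Fin k)).image fun j'' => (Φ i' j'').1).card := Finset.card_biUnion_le
            _ ≤ ∑ _i' ∈ ((univ : Finset (Fin m)).filter fun i' => ∃ j', (Φ i' j').1 = (Φ a j).1), k := by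
                refine Finset.sum_le_sum fun i' _ => ?_
                calc _ ≤ (univ : Finset (Fin k)).card := Finset.card_image_le
                  _ = k := by rw [Finset.card_univ, Fintype.card_fin]
            _ = (((univ : Finset (Fin m)).filter fun i' => ∃ j', (Φ i' j').1 = (Φ a j).1).card) * k := by
                rw [Finset.sum_const, smul_eq_mul]
            _ ≤ D * k := Nat.mul_le_mul_right k (hcdeg j)
            _ = k * D := Nat.mul_comm _ _
      _ = k * (k * D) := by rw [Finset.sum_const, Finset.card_univ, Fintype.card_fin, smul_eq_mul]
  calc _ ≤ (A ∪ B).card := Finset.card_le_card hsub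
    _ ≤ A.card + B.card := Finset.card_union_le _ _
    _ ≤ k + k * (k * D) := Nat.add_le_add hA' hB'

/-- **Locality ⇒ bounded differences.** For a two-round local rule `g` (hypothesis `hloc`) and two
instances that agree off clause `a`, the outputs differ only at variables that see clause `a` in one of
the two instances. -/
theorem shwLoc_hamming_le (g : (Fin m → Fin k → Fin n × Bool) → (Fin n → Bool))
    (hloc : ∀ (Φ Φ' : Fin m → Fin k → Fin n × Bool) (v : Fin n),
      (∀ i : Fin m,
        ((∃ j : Fin k, ((Φ i j).1 = v ∨
            ∃ i' : Fin m, (∃ j', (Φ i' j').1 = v) ∧ ∃ j', (Φ i' j').1 = (Φ i j).1)) ∨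
         (∃ j : Fin k, ((Φ' i j).1 = v ∨
            ∃ i' : Fin m, (∃ j', (Φ' i' j').1 = v) ∧ ∃ j', (Φ' i' j').1 = (Φ' i j).1))) →
        Φ i = Φ' i) →
      g Φ v = g Φ' v)
    (Φ Φ' : Fin m → Fin k → Fin n × Bool) (a : Fin m) (hoff : ∀ i, i ≠ a → Φ i = Φ' i) :
    hammingDist (g Φ) (g Φ') ≤
      ((univ : Finset (Fin n)).filter fun v => ∃ j : Fin k, ((Φ a j).1 = v ∨
        ∃ i' : Fin m, (∃ j', (Φ i' j').1 = v) ∧ ∃ j', (Φ i' j').1 = (Φ a j).1)).card +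
      ((univ : Finset (Fin n)).filter fun v => ∃ j : Fin k, ((Φ' a j).1 = v ∨
        ∃ i' : Fin m, (∃ j', (Φ' i' j').1 = v) ∧ ∃ j', (Φ' i' j').1 = (Φ' a j).1)).card := by
  set S : Finset (Fin n) := (univ : Finset (Fin n)).filter fun v => ∃ j : Fin k, ((Φ a j).1 = v ∨
      ∃ i' : Fin m, (∃ j', (Φ i' j').1 = v) ∧ ∃ j', (Φ i' j').1 = (Φ a j).1) with hS
  set S' : Finset (Fin n) := (univ : Finset (Fin n)).filter fun v => ∃ j : Fin k, ((Φ' a j).1 = v ∨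
      ∃ i' : Fin m, (∃ j', (Φ' i' j').1 = v) ∧ ∃ j', (Φ' i' j').1 = (Φ' a j).1) with hS'
  have hsub : ((univ : Finset (Fin n)).filter fun v => g Φ v ≠ g Φ' v) ⊆ S ∪ S' := by
    intro v hv
    simp only [mem_filter, mem_univ, true_and] at hv
    by_contra hnot
    rw [Finset.mem_union, not_or] at hnot
    apply hv
    apply hloc Φ Φ' v
    intro i hi
    by_cases hia : i = a
    · subst hia
      exfalso
      rcases hi with hi | hi
      · exact hnot.1 (by rw [hS]; exact Finset.mem_filter.2 ⟨mem_univ _, hi⟩)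
      · exact hnot.2 (by rw [hS']; exact Finset.mem_filter.2 ⟨mem_univ _, hi⟩)
    · exact hoff i hia
  calc hammingDist (g Φ) (g Φ') = ((univ : Finset (Fin n)).filter fun v => g Φ v ≠ g Φ' v).card := rfl
    _ ≤ (S ∪ S').card := Finset.card_le_card hsub
    _ ≤ S.card + S'.card := Finset.card_union_le _ _

/-- **Two-round local rules are typically Lipschitz.** Under `hloc`, a single-literal change moves the
output by at most `2k + k²(2 D(Φ) + 1)` in Hamming distance (`D(Φ)` the maximum clause-degree of the
instance before the change; the changed instance has maximum clause-degree `≤ D(Φ) + 1`). -/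
theorem shwLoc_hamming_update_le (g : (Fin m → Fin k → Fin n × Bool) → (Fin n → Bool))
    (hloc : ∀ (Φ Φ' : Fin m → Fin k → Fin n × Bool) (v : Fin n),
      (∀ i : Fin m,
        ((∃ j : Fin k, ((Φ i j).1 = v ∨
            ∃ i' : Fin m, (∃ j', (Φ i' j').1 = v) ∧ ∃ j', (Φ i' j').1 = (Φ i j).1)) ∨
         (∃ j : Fin k, ((Φ' i j).1 = v ∨
            ∃ i' : Fin m, (∃ j', (Φ' i' j').1 = v) ∧ ∃ j', (Φ' i' j').1 = (Φ' i j).1))) →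
        Φ i = Φ' i) →
      g Φ v = g Φ' v)
    (Φ : Fin m → Fin k → Fin n × Bool) (a : Fin m) (b : Fin k) (ℓ : Fin n × Bool) :
    (hammingDist (g Φ) (g (Function.update Φ a (Function.update (Φ a) b ℓ))) : ℝ)
      ≤ 2 * k + k * k * (2 * ((univ : Finset (Fin n)).sup fun v =>
          ((univ : Finset (Fin m)).filter fun i => ∃ j, (Φ i j).1 = v).card : ℕ) + 1) := by
  set Φ' := Function.update Φ a (Function.update (Φ a) b ℓ) with hΦ'
  set D : ℕ := (univ : Finset (Fin n)).sup fun v =>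
      ((univ : Finset (Fin m)).filter fun i => ∃ j, (Φ i j).1 = v).card with hD
  set D' : ℕ := (univ : Finset (Fin n)).sup fun v =>
      ((univ : Finset (Fin m)).filter fun i => ∃ j, (Φ' i j).1 = v).card with hD'
  have hoff : ∀ i, i ≠ a → Φ i = Φ' i := fun i hi => by rw [hΦ', Function.update_of_ne hi]
  have h1 := shwLoc_hamming_le g hloc Φ Φ' a hoff
  have h2 := shwLoc_card_sees_le Φ a
  have h3 := shwLoc_card_sees_le Φ' a
  have hDD : D' ≤ D + 1 := by
    rw [hD', hD, hΦ']
    exact sissT_maxdeg_update_le Φ a (Function.update (Φ a) b ℓ)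
  have hnat : hammingDist (g Φ) (g Φ') ≤ (k + k * (k * D)) + (k + k * (k * (D + 1))) := by
    calc hammingDist (g Φ) (g Φ') ≤ _ := h1
      _ ≤ (k + k * (k * D)) + (k + k * (k * D')) := Nat.add_le_add h2 h3
      _ ≤ (k + k * (k * D)) + (k + k * (k * (D + 1))) := by
          have := Nat.mul_le_mul_left k (Nat.mul_le_mul_left k hDD)
          omega
  have hR : ((hammingDist (g Φ) (g Φ') : ℕ) : ℝ) ≤ (((k + k * (k * D)) + (k + k * (k * (D + 1))) : ℕ) : ℝ) := by
    exact_mod_cast hnat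
  push_cast at hR
  have hrew : ((k : ℝ) + k * (k * D)) + (k + k * (k * (D + 1))) = 2 * k + k * k * (2 * (D : ℝ) + 1) := by
    ring
  rw [hrew] at hR
  exact hR

/-- **Typically Lipschitz ⇒ ℓ²-stable (the bridge).** If `1 ≤ n`, `m ≤ α n`, `e^{αke²} ≤ n³`, and `g`
moves by at most `s` under every single-literal change at every instance of maximum clause-degree
`≤ 3 log n`, then its mean-square single-literal-resample sensitivity is at most `s² + 1`:
`∑_{(a,b)} ∑_{(Φ,ℓ)} d_H(g Φ, g Φ[(a,b) ↦ ℓ])² ≤ (s² + 1)·(m k)·#Inst·2n` (the instances of maximum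
clause-degree `> 3 log n` are a `≤ e^{αke²} n^{-5}` fraction and contribute at most `n²` each). -/
theorem shwLoc_meanSquare_of_typLipschitz (hn : 1 ≤ n) (α : ℝ) (hα : 0 ≤ α) (hm : (m : ℝ) ≤ α * n)
    (hlarge : Real.exp (α * k * Real.exp 2) ≤ (n : ℝ) ^ 3)
    (g : (Fin m → Fin k → Fin n × Bool) → (Fin n → Bool)) (s : ℝ)
    (hg : ∀ (Φ : Fin m → Fin k → Fin n × Bool),
      (((univ : Finset (Fin n)).sup fun v =>
        ((univ : Finset (Fin m)).filter fun i => ∃ j, (Φ i j).1 = v).card : ℕ) : ℝ)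
          ≤ 3 * Real.log n →
      ∀ (a : Fin m) (b : Fin k) (ℓ : Fin n × Bool),
        (hammingDist (g Φ) (g (Function.update Φ a (Function.update (Φ a) b ℓ))) : ℝ) ≤ s) :
    (∑ a : Fin m, ∑ b : Fin k, ∑ p : (Fin m → Fin k → Fin n × Bool) × (Fin n × Bool),
        (hammingDist (g p.1) (g (Function.update p.1 a (Function.update (p.1 a) b p.2))) : ℝ) ^ 2)
      ≤ (s ^ 2 + 1) * (((m * k : ℕ) : ℝ) * (Fintype.card (Fin m → Fin k → Fin n × Bool) * (2 * n))) := by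
  have hnR : (1 : ℝ) ≤ n := by exact_mod_cast hn
  have hnpos : (0 : ℝ) < n := by linarith only [hnR]
  set N : ℝ := (Fintype.card (Fin m → Fin k → Fin n × Bool) : ℝ) with hN
  have hNnn : 0 ≤ N := by rw [hN]; exact Nat.cast_nonneg _
  set Dr : (Fin m → Fin k → Fin n × Bool) → ℝ := fun Φ =>
    (((univ : Finset (Fin n)).sup fun v =>
      ((univ : Finset (Fin m)).filter fun i => ∃ j, (Φ i j).1 = v).card : ℕ) : ℝ) with hDr
  set d : Fin m → Fin k → (Fin m → Fin k → Fin n × Bool) → (Fin n × Bool) → ℝ := fun a b Φ ℓ =>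
    (hammingDist (g Φ) (g (Function.update Φ a (Function.update (Φ a) b ℓ))) : ℝ) with hd
  -- the exceptional set `Bad = {Φ : 3 log n < D Φ}` and its size
  set L' : ℕ := ⌊3 * Real.log n⌋₊ with hL'
  set BadS : Finset (Fin m → Fin k → Fin n × Bool) := (univ : Finset (Fin m → Fin k → Fin n × Bool)).filter
      fun Φ => L' < (univ : Finset (Fin n)).sup fun v =>
        ((univ : Finset (Fin m)).filter fun i => ∃ j, (Φ i j).1 = v).card with hBadS
  have hcardC : (Fintype.card (Fin n × Bool) : ℝ) = 2 * n := by
    rw [Fintype.card_prod, Fintype.card_fin, Fintype.card_bool]; push_cast; ring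
  have hBadR : (n : ℝ) ^ 2 * (BadS.card : ℝ) ≤ N := by
    have htail := shwL_card_maxdeg_gt_le_real (m := m) (k := k) (n := n) L' hα hn hm
    rw [← hBadS] at htail
    have hlog0 : 0 ≤ Real.log n := Real.log_nonneg hnR
    have hL1 : 3 * Real.log n ≤ (L' : ℝ) + 1 := by
      have := Nat.lt_floor_add_one (3 * Real.log n)
      rw [← hL'] at this
      exact this.le
    have hexpL : Real.exp (-(2 * ((L' : ℝ) + 1))) ≤ ((n : ℝ) ^ 6)⁻¹ := by
      rw [Real.exp_neg]
      apply inv_anti₀ (by positivity)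
      calc (n : ℝ) ^ 6 = Real.exp (6 * Real.log n) := by
            rw [show (6 : ℝ) * Real.log n = ((6 : ℕ) : ℝ) * Real.log n by norm_num, Real.exp_nat_mul,
              Real.exp_log hnpos]
        _ ≤ Real.exp (2 * ((L' : ℝ) + 1)) := Real.exp_le_exp.2 (by linarith only [hL1])
    have h1 : (BadS.card : ℝ) ≤ n * (Real.exp (α * k * Real.exp 2) * ((n : ℝ) ^ 6)⁻¹) * N := by
      calc (BadS.card : ℝ) ≤ n * (Real.exp (α * k * Real.exp 2) * Real.exp (-(2 * (L' + 1)))) * N := htail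
        _ ≤ n * (Real.exp (α * k * Real.exp 2) * ((n : ℝ) ^ 6)⁻¹) * N := by gcongr
    have h2 : (n : ℝ) ^ 2 * (n * (Real.exp (α * k * Real.exp 2) * ((n : ℝ) ^ 6)⁻¹) * N)
        = Real.exp (α * k * Real.exp 2) * ((n : ℝ) ^ 3)⁻¹ * N := by
      field_simp
    have h3 : Real.exp (α * k * Real.exp 2) * ((n : ℝ) ^ 3)⁻¹ ≤ 1 := by
      rw [← div_eq_mul_inv, div_le_one (by positivity)]
      exact hlarge
    calc (n : ℝ) ^ 2 * (BadS.card : ℝ)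
        ≤ (n : ℝ) ^ 2 * (n * (Real.exp (α * k * Real.exp 2) * ((n : ℝ) ^ 6)⁻¹) * N) :=
          mul_le_mul_of_nonneg_left h1 (by positivity)
      _ = Real.exp (α * k * Real.exp 2) * ((n : ℝ) ^ 3)⁻¹ * N := h2
      _ ≤ 1 * N := mul_le_mul_of_nonneg_right h3 hNnn
      _ = N := one_mul _
  -- pointwise: `d² ≤ s² + n²·1_{Bad}`
  have hpt : ∀ (a : Fin m) (b : Fin k) (Φ : Fin m → Fin k → Fin n × Bool) (ℓ : Fin n × Bool),
      d a b Φ ℓ ^ 2 ≤ s ^ 2 + (n : ℝ) ^ 2 * (if Φ ∈ BadS then 1 else 0) := by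
    intro a b Φ ℓ
    have hd0 : 0 ≤ d a b Φ ℓ := Nat.cast_nonneg _
    have hdn : d a b Φ ℓ ≤ n := by
      have := @hammingDist_le_card_fintype _ (fun _ => Bool) _ _ (g Φ)
        (g (Function.update Φ a (Function.update (Φ a) b ℓ)))
      rw [Fintype.card_fin] at this
      simp only [hd]
      exact_mod_cast this
    by_cases hΦ : Φ ∈ BadS
    · rw [if_pos hΦ, mul_one]
      have : d a b Φ ℓ ^ 2 ≤ (n : ℝ) ^ 2 := pow_le_pow_left₀ hd0 hdn 2
      linarith only [this, sq_nonneg s]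
    · rw [if_neg hΦ, mul_zero, add_zero]
      have htyp : Dr Φ ≤ 3 * Real.log n := by
        rw [hBadS, Finset.mem_filter, not_and] at hΦ
        have hle : ((univ : Finset (Fin n)).sup fun v =>
            ((univ : Finset (Fin m)).filter fun i => ∃ j, (Φ i j).1 = v).card) ≤ L' :=
          not_lt.1 (hΦ (mem_univ _))
        have hle' : Dr Φ ≤ (L' : ℝ) := by simp only [hDr]; exact_mod_cast hle
        exact hle'.trans (Nat.floor_le (by positivity))
      have h1 : d a b Φ ℓ ≤ s := by simp only [hd]; exact hg Φ (by simpa only [hDr] using htyp) a b ℓ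
      exact pow_le_pow_left₀ hd0 h1 2
  -- sum over `(Φ, ℓ)` at a fixed position
  have hpos_ab : ∀ (a : Fin m) (b : Fin k),
      ∑ p : (Fin m → Fin k → Fin n × Bool) × (Fin n × Bool), d a b p.1 p.2 ^ 2
        ≤ (s ^ 2 + 1) * (N * (2 * n)) := by
    intro a b
    have hp : ∑ p : (Fin m → Fin k → Fin n × Bool) × (Fin n × Bool), d a b p.1 p.2 ^ 2
        = ∑ Φ : Fin m → Fin k → Fin n × Bool, ∑ ℓ : Fin n × Bool, d a b Φ ℓ ^ 2 :=
      Fintype.sum_prod_type' (fun Φ ℓ => d a b Φ ℓ ^ 2)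
    rw [hp]
    calc ∑ Φ : Fin m → Fin k → Fin n × Bool, ∑ ℓ : Fin n × Bool, d a b Φ ℓ ^ 2
        ≤ ∑ Φ : Fin m → Fin k → Fin n × Bool, ∑ _ℓ : Fin n × Bool,
            (s ^ 2 + (n : ℝ) ^ 2 * (if Φ ∈ BadS then 1 else 0)) :=
          Finset.sum_le_sum fun Φ _ => Finset.sum_le_sum fun ℓ _ => hpt a b Φ ℓ
      _ = (2 * n) * (s ^ 2 * N + (n : ℝ) ^ 2 * (BadS.card : ℝ)) := by
          have h1 : ∀ Φ : Fin m → Fin k → Fin n × Bool, ∑ _ℓ : Fin n × Bool,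
              (s ^ 2 + (n : ℝ) ^ 2 * (if Φ ∈ BadS then (1 : ℝ) else 0))
                = (2 * n) * (s ^ 2 + (n : ℝ) ^ 2 * (if Φ ∈ BadS then (1 : ℝ) else 0)) := by
            intro Φ
            rw [Finset.sum_const, Finset.card_univ, nsmul_eq_mul, hcardC]
          simp only [h1]
          rw [← Finset.mul_sum, Finset.sum_add_distrib, Finset.sum_const, Finset.card_univ, nsmul_eq_mul,
            ← Finset.mul_sum, Finset.sum_boole, hN]
          congr 1
          have : ((univ : Finset (Fin m → Fin k → Fin n × Bool)).filter fun Φ => Φ ∈ BadS) = BadS := by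
            ext Φ; simp
          rw [this]
          ring
      _ ≤ (2 * n) * (s ^ 2 * N + N) := by
          apply mul_le_mul_of_nonneg_left _ (by positivity)
          linarith only [hBadR]
      _ = (s ^ 2 + 1) * (N * (2 * n)) := by ring
  -- sum over the positions
  calc (∑ a : Fin m, ∑ b : Fin k, ∑ p : (Fin m → Fin k → Fin n × Bool) × (Fin n × Bool),
        (hammingDist (g p.1) (g (Function.update p.1 a (Function.update (p.1 a) b p.2))) : ℝ) ^ 2)
      = ∑ a : Fin m, ∑ b : Fin k, ∑ p : (Fin m → Fin k → Fin n × Bool) × (Fin n × Bool),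
          d a b p.1 p.2 ^ 2 := by simp only [hd]
    _ ≤ ∑ _a : Fin m, ∑ _b : Fin k, (s ^ 2 + 1) * (N * (2 * n)) :=
        Finset.sum_le_sum fun a _ => Finset.sum_le_sum fun b _ => hpos_ab a b
    _ = (s ^ 2 + 1) * (((m * k : ℕ) : ℝ) * (N * (2 * n))) := by
        rw [Finset.sum_const, Finset.card_univ, Fintype.card_fin, Finset.sum_const, Finset.card_univ,
          Fintype.card_fin, nsmul_eq_mul, nsmul_eq_mul]
        push_cast
        ring

end TwoRound

end Summit.PneNP.PneNP.Theorems
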